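import Summits.BirchSwinnertonDyer.Rank1Residual.Additive.PadicBallLog
import Mathlib.Analysis.SpecificLimits.Basic
import HarnessLib

/-!
# Local surjectivity of the logarithm of `E₁(K)`: every `y` with `‖y‖ ≤ 1/4` is `Λ(P)` for some
# `P ∈ E₁(K)` with `‖z(P)‖ ≤ ‖y‖` (successive approximation in the complete field `K ⊇ ℚ_p`)
# (cell `b2b-bsdres`, CLASS-CLOSURE lane, class O10 — x1b GEN 33, class lead; file 30 of the local
# series: the step "`pᴺ𝒪 ⊆ Λ(p^{N−N₀}E₁)`" absorbing `ℤ_p`-versus-`ℤ` coefficient errors in [K] Prop. 8.11)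

HONEST FRAMING (cell `b2b-bsdres`, run/shared/lean/b2b/bsd-rank1-residual/, verbatim in every
file): the goal of the cell is to DELETE the COMBINATION-SHAPED residual classes of the
Birch–Swinnerton-Dyer formula for ALL analytic-rank `≤ 1` elliptic curves over `ℚ` — "full BSD
formula for every rank `≤ 1` curve in class `C`" assembled STRICTLY from published theorems — so
that the rank-`≤ 1` remainder becomes exactly the CONSTRUCTION-SHAPED classes, which are TYPED
(missing-input `Prop`s), NOT attempted. This is not "finishing BSD". CLASS-CLOSURE lane: prove
what is provable now; shrink each hard class to its core with data; no claim beyond stated classes;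
research routes on CONSTRUCTION-SHAPED X12 / O10; census / instrument output = EVIDENCE / conjecture
items, NEVER a Literature fact; `RESIDUAL-MAP.md` marks change only by signed lines. THIS FILE:
TOOL DEFINITIONS + THEOREMS (definitions with bodies: `pt`, `corr`; every statement proved) — no
named Literature fact, no Summits-side fact `def … : Prop`, no `sorry`, axioms standard; nothing is
booked; no label / mark / count / sub-cell moves; O10 stays OPEN / CONSTRUCTION-SHAPED; nothing
about `BSD(W, p)` of any pair is claimed.

## Content (notation of `PadicBallLog`; `Λ = ptLog`, `P(x) = pt x` the formal point of parameter `x`)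

* §1 `pt x` (the formal point of parameter `x` for `‖x‖ < 1`, `O` otherwise), `Λ(pt x) = bLog x`;
  the correction map `corr x = x − Λ(pt x)` with `‖corr x‖ ≤ 2‖x‖² ≤ ‖x‖/2` on `‖x‖ ≤ 1/4`;
  the iterates `rₙ = corrⁿ(y)`: `‖rₙ‖ ≤ ‖y‖/2ⁿ`.
* §2 the partial sums `Sₙ = ∑_{i<n} pt rᵢ ∈ E₁(K)`: `Λ(Sₙ) = y − rₙ` (telescoping, additivity of `Λ`),
  `‖z(Sₙ)‖ ≤ ‖y‖`, `z(Sₙ)` is Cauchy (isometry `‖z(P − Q)‖ = ‖z P − z Q‖`).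
* §3 **`exists_ptLog_eq`: for `‖y‖ ≤ 1/4` there is `P ∈ E₁(K)` with `Λ(P) = y` and `‖z(P)‖ ≤ ‖y‖`**
  (`P = pt (lim z(Sₙ))`; continuity of `Λ` at deep level is the isometry `‖Λ(Q)‖ = ‖z(Q)‖`).

References: [SilvermanAEC2009] IV.6.4 (b) (`log` is an isomorphism on deep levels); [Kobayashi2003]
Prop. 8.11 (proof).
-/

noncomputable section

open scoped Classical Topology NNReal
open Filter PowerSeries

namespace Summit.BirchSwinnertonDyer.Rank1Residual.Additive

namespace BallEval

open Literature.NumberTheory.GaloisRepresentations.LubinTate (unitBall mem_unitBall_iff)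
open Literature.NumberTheory.EllipticCurves Literature.NumberTheory.EllipticCurves.FormalGroupChart
open WeierstrassCurve

variable (p : ℕ) [hp : Fact p.Prime] (K : Type*) [NontriviallyNormedField K] [NormedAlgebra ℚ_[p] K]
  [IsUltrametricDist K] [CompleteSpace K] (M : WeierstrassCurve ℤ_[p])
  [hE : (M.map PadicInt.Coe.ringHom).IsElliptic]
  [hint : (curveK p K M).IsIntegral (NormedField.valuation (K := K)).integer]

/-! ## §1 The formal point of a parameter in `K` and the correction map -/

/-- **`pt x`**: the formal point of parameter `x` (`O` if `‖x‖ ≥ 1`). [folklore] -/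
def pt (x : K) : (curveK p K M).toAffine.Point :=
  if hx : ‖x‖ < 1 then ptOf p K M ⟨x, (mem_unitBall_iff K).mpr hx.le⟩ hx else 0

variable {p K M}

omit hint in
/-- `pt x` for `‖x‖ < 1`. [folklore] -/
theorem pt_of_lt {x : K} (hx : ‖x‖ < 1) : pt p K M x = ptOf p K M ⟨x, (mem_unitBall_iff K).mpr hx.le⟩ hx := by
  rw [pt, dif_pos hx]

/-- `pt x ∈ E₁(K)`. [folklore] -/
theorem pt_mem_kernel (x : K) : pt p K M x ∈ kernel (NormedField.valuation (K := K)) (curveK p K M) := by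
  by_cases hx : ‖x‖ < 1
  · rw [pt_of_lt hx]; exact ptOf_mem_kernel hx
  · rw [pt, dif_neg hx]; exact (kernel (NormedField.valuation (K := K)) (curveK p K M)).zero_mem

omit hint in
/-- `z(pt x) = x` for `‖x‖ < 1`. [folklore] -/
theorem zCoord_pt {x : K} (hx : ‖x‖ < 1) : (pt p K M x).zCoord = x := by
  rw [pt_of_lt hx, zCoord_ptOf]

omit hint in
/-- `Λ(pt x) = bLog x` for `‖x‖ < 1`. [folklore] -/
theorem ptLog_pt {x : K} (hx : ‖x‖ < 1) : ptLog p K M (pt p K M x) = bLog p K M x := by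
  rw [ptLog, zCoord_pt hx]

variable (p K M) in
/-- **The correction map `corr x = x − Λ(pt x)`.** [folklore] -/
def corr (x : K) : K := x - ptLog p K M (pt p K M x)

omit hint in
/-- `‖corr x‖ ≤ 2‖x‖²` for `‖x‖ ≤ 1/2`. [folklore] -/
theorem norm_corr_le {x : K} (hx : ‖x‖ ≤ 1 / 2) : ‖corr p K M x‖ ≤ ‖x‖ ^ 2 * 2 := by
  have hx1 : ‖x‖ < 1 := hx.trans_lt (by norm_num)
  rw [corr, ptLog_pt hx1, ← norm_neg, neg_sub]
  exact norm_bLog_sub_le_two hx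

omit hint in
/-- `‖corr x‖ ≤ ‖x‖/2` for `‖x‖ ≤ 1/4`. [folklore] -/
theorem norm_corr_le_half {x : K} (hx : ‖x‖ ≤ 1 / 4) : ‖corr p K M x‖ ≤ ‖x‖ / 2 := by
  refine (norm_corr_le (hx.trans (by norm_num))).trans ?_
  have h0 := norm_nonneg x
  nlinarith

omit hint in
/-- The iterates `rₙ = corrⁿ(y)` satisfy `‖rₙ‖ ≤ ‖y‖ / 2ⁿ` (for `‖y‖ ≤ 1/4`). [folklore] -/
theorem norm_iterate_corr_le {y : K} (hy : ‖y‖ ≤ 1 / 4) (n : ℕ) : ‖(corr p K M)^[n] y‖ ≤ ‖y‖ / 2 ^ n := by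
  induction n with
  | zero => simp
  | succ n ih =>
    rw [Function.iterate_succ_apply']
    have hn : ‖(corr p K M)^[n] y‖ ≤ 1 / 4 := ih.trans ((div_le_self (norm_nonneg y) (one_le_pow₀ one_le_two)).trans hy)
    refine (norm_corr_le_half hn).trans ?_
    rw [pow_succ, ← div_div]
    exact div_le_div_of_nonneg_right ih zero_le_two

omit hint in
/-- Hence `‖rₙ‖ ≤ ‖y‖`. [folklore] -/
theorem norm_iterate_corr_le' {y : K} (hy : ‖y‖ ≤ 1 / 4) (n : ℕ) : ‖(corr p K M)^[n] y‖ ≤ ‖y‖ :=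
  (norm_iterate_corr_le hy n).trans (div_le_self (norm_nonneg y) (one_le_pow₀ one_le_two))

/-! ## §2 The partial sums -/

/-- **`Λ(∑_{i<n} pt rᵢ) = y − rₙ`** (telescoping: `Λ(pt rᵢ) = rᵢ − r_{i+1}`). [folklore] -/
theorem ptLog_sum_pt_iterate (y : K) (n : ℕ) :
    ptLog p K M (∑ i ∈ Finset.range n, pt p K M ((corr p K M)^[i] y)) = y - (corr p K M)^[n] y := by
  induction n with
  | zero => rw [Finset.sum_range_zero, ptLog_zero, Function.iterate_zero_apply, sub_self]
  | succ n ih =>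
    rw [Finset.sum_range_succ, ptLog_add ((kernel (NormedField.valuation (K := K)) (curveK p K M)).sum_mem fun _ _ => pt_mem_kernel _) (pt_mem_kernel _), ih,
      Function.iterate_succ_apply', corr]
    ring

/-- The sums lie in `E₁(K)`. [folklore] -/
theorem sum_pt_mem_kernel (y : K) (n : ℕ) :
    (∑ i ∈ Finset.range n, pt p K M ((corr p K M)^[i] y)) ∈ kernel (NormedField.valuation (K := K)) (curveK p K M) :=
  (kernel (NormedField.valuation (K := K)) (curveK p K M)).sum_mem fun _ _ => pt_mem_kernel _

omit [CompleteSpace K] hE in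
/-- Norm form of the chart estimate `|z(P + Q)| ≤ max |z P| |z Q|`. [folklore] -/
theorem norm_zCoord_add_le {P Q : (curveK p K M).toAffine.Point}
    (hP : P ∈ kernel (NormedField.valuation (K := K)) (curveK p K M))
    (hQ : Q ∈ kernel (NormedField.valuation (K := K)) (curveK p K M)) :
    ‖(P + Q).zCoord‖ ≤ max ‖P.zCoord‖ ‖Q.zCoord‖ := by
  have h := val_zCoord_add_le (w := NormedField.valuation (K := K)) hP hQ
  have h' : ((NormedField.valuation (K := K) (P + Q).zCoord : ℝ≥0) : ℝ) ≤
      ((max (NormedField.valuation (K := K) P.zCoord) (NormedField.valuation (K := K) Q.zCoord) : ℝ≥0) : ℝ) := by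
    exact_mod_cast h
  simpa [NormedField.valuation_apply, NNReal.coe_max] using h'

omit [CompleteSpace K] hE in
/-- Norm form of the isometry `|z(P − Q)| = |z P − z Q|`. [folklore] -/
theorem norm_zCoord_sub_eq {P Q : (curveK p K M).toAffine.Point}
    (hP : P ∈ kernel (NormedField.valuation (K := K)) (curveK p K M))
    (hQ : Q ∈ kernel (NormedField.valuation (K := K)) (curveK p K M)) :
    ‖(P - Q).zCoord‖ = ‖P.zCoord - Q.zCoord‖ := by
  have h := val_zCoord_sub (w := NormedField.valuation (K := K)) hP hQ
  have h' := congrArg (fun x : ℝ≥0 => (x : ℝ)) h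
  simp only [NormedField.valuation_apply, coe_nnnorm] at h'
  linarith [h', h'.symm]

/-- `‖z(Sₙ)‖ ≤ ‖y‖`. [folklore] -/
theorem norm_zCoord_sum_le {y : K} (hy : ‖y‖ ≤ 1 / 4) (n : ℕ) :
    ‖(∑ i ∈ Finset.range n, pt p K M ((corr p K M)^[i] y)).zCoord‖ ≤ ‖y‖ := by
  induction n with
  | zero => rw [Finset.sum_range_zero, Affine.Point.zCoord_zero, norm_zero]; exact norm_nonneg y
  | succ n ih =>
    rw [Finset.sum_range_succ]
    refine (norm_zCoord_add_le (sum_pt_mem_kernel y n) (pt_mem_kernel _)).trans (max_le ih ?_)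
    have h1 : ‖(corr p K M)^[n] y‖ < 1 := (norm_iterate_corr_le' hy n).trans_lt (hy.trans_lt (by norm_num))
    rw [zCoord_pt h1]
    exact norm_iterate_corr_le' hy n

/-- Consecutive differences: `‖z(S_{n+1}) − z(Sₙ)‖ ≤ ‖y‖/2ⁿ`. [folklore] -/
theorem norm_zCoord_sum_succ_sub_le {y : K} (hy : ‖y‖ ≤ 1 / 4) (n : ℕ) :
    ‖(∑ i ∈ Finset.range (n + 1), pt p K M ((corr p K M)^[i] y)).zCoord -
      (∑ i ∈ Finset.range n, pt p K M ((corr p K M)^[i] y)).zCoord‖ ≤ ‖y‖ / 2 ^ n := by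
  have h1 : ‖(corr p K M)^[n] y‖ < 1 := (norm_iterate_corr_le' hy n).trans_lt (hy.trans_lt (by norm_num))
  rw [← norm_zCoord_sub_eq (sum_pt_mem_kernel y (n + 1)) (sum_pt_mem_kernel y n), Finset.sum_range_succ,
    add_sub_cancel_left, zCoord_pt h1]
  exact norm_iterate_corr_le hy n

/-! ## §3 Local surjectivity -/

/-- **Local surjectivity of `Λ`**: for `‖y‖ ≤ 1/4` there is `P ∈ E₁(K)` with `Λ(P) = y` and
`‖z(P)‖ ≤ ‖y‖`. [cite: SilvermanAEC2009, IV.6.4] -/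
theorem exists_ptLog_eq {y : K} (hy : ‖y‖ ≤ 1 / 4) :
    ∃ P ∈ kernel (NormedField.valuation (K := K)) (curveK p K M), ptLog p K M P = y ∧ ‖P.zCoord‖ ≤ ‖y‖ := by
  set S : ℕ → (curveK p K M).toAffine.Point := fun n => ∑ i ∈ Finset.range n, pt p K M ((corr p K M)^[i] y) with hS
  set s : ℕ → K := fun n => (S n).zCoord with hs
  -- `s` is Cauchy, hence converges
  have hcau : CauchySeq s := by
    refine cauchySeq_of_le_geometric_two (C := 2 * ‖y‖) fun n => ?_
    rw [mul_div_cancel_left₀ _ (two_ne_zero : (2 : ℝ) ≠ 0), dist_eq_norm, ← norm_neg, neg_sub]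
    exact norm_zCoord_sum_succ_sub_le (p := p) (M := M) hy n
  obtain ⟨ℓ, hℓ⟩ := cauchySeq_tendsto_of_complete hcau
  have hℓy : ‖ℓ‖ ≤ ‖y‖ :=
    le_of_tendsto (continuous_norm.continuousAt.tendsto.comp hℓ) (Filter.Eventually.of_forall fun n =>
      norm_zCoord_sum_le (p := p) (M := M) hy n)
  have hℓ1 : ‖ℓ‖ < 1 := hℓy.trans_lt (hy.trans_lt (by norm_num))
  refine ⟨pt p K M ℓ, pt_mem_kernel (p := p) (M := M) ℓ, ?_, by rw [zCoord_pt hℓ1]; exact hℓy⟩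
  -- `Λ(pt ℓ) = Λ(pt ℓ − Sₙ) + Λ(Sₙ)`, `Λ(Sₙ) = y − rₙ → y`, `‖Λ(pt ℓ − Sₙ)‖ = ‖ℓ − sₙ‖ → 0`
  have hPm : pt p K M ℓ ∈ kernel (NormedField.valuation (K := K)) (curveK p K M) := pt_mem_kernel ℓ
  have key : ∀ n, ptLog p K M (pt p K M ℓ) - y =
      ptLog p K M (pt p K M ℓ - S n) - (corr p K M)^[n] y := by
    intro n
    have hadd := ptLog_add ((kernel (NormedField.valuation (K := K)) (curveK p K M)).sub_mem hPm (sum_pt_mem_kernel y n)) (sum_pt_mem_kernel (p := p) (K := K) (M := M) y n)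
    rw [sub_add_cancel] at hadd
    rw [hadd, ptLog_sum_pt_iterate y n]
    simp only [hS]
    ring
  -- estimate both terms
  rw [← sub_eq_zero, ← norm_le_zero_iff]
  refine le_of_forall_pos_le_add fun ε hε => ?_
  rw [zero_add]
  -- choose `n` with `‖ℓ − sₙ‖ < ε` (and small enough for the isometry) and `‖y‖/2ⁿ < ε`
  have h1 : ∀ᶠ n in atTop, ‖s n - ℓ‖ < min ε (1 / 4) := by
    have := (tendsto_iff_norm_sub_tendsto_zero.mp hℓ)
    exact this.eventually (gt_mem_nhds (lt_min hε (by norm_num)))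
  have h2 : ∀ᶠ n : ℕ in atTop, ‖y‖ / 2 ^ n < ε := by
    have ht : Tendsto (fun n : ℕ => ‖y‖ / 2 ^ n) atTop (𝓝 0) := by
      have h := (tendsto_pow_atTop_nhds_zero_of_lt_one (by norm_num : (0:ℝ) ≤ 1 / 2)
        (by norm_num : (1 / 2 : ℝ) < 1)).const_mul ‖y‖
      rw [mul_zero] at h
      refine h.congr fun n => ?_
      rw [one_div, inv_pow, div_eq_mul_inv]
    exact ht.eventually (gt_mem_nhds hε)
  obtain ⟨n, hn1, hn2⟩ := (h1.and h2).exists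
  rw [key n]
  have hdiff : ‖(pt p K M ℓ - S n).zCoord‖ < min ε (1 / 4) := by
    rw [norm_zCoord_sub_eq hPm (sum_pt_mem_kernel y n), zCoord_pt hℓ1, ← norm_neg, neg_sub]
    exact hn1
  have hL : ‖ptLog p K M (pt p K M ℓ - S n)‖ < ε := by
    rw [norm_ptLog_eq (hdiff.trans_le ((min_le_right _ _).trans (by norm_num)))]
    exact hdiff.trans_le (min_le_left _ _)
  calc ‖ptLog p K M (pt p K M ℓ - S n) - (corr p K M)^[n] y‖
      ≤ max ‖ptLog p K M (pt p K M ℓ - S n)‖ ‖(corr p K M)^[n] y‖ := by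
        rw [sub_eq_add_neg]
        refine (IsUltrametricDist.norm_add_le_max _ _).trans (by rw [norm_neg])
    _ ≤ ε := max_le hL.le ((norm_iterate_corr_le hy n).trans hn2.le)

end BallEval

end Summit.BirchSwinnertonDyer.Rank1Residual.Additive

end
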